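import Summits.QuantumFields.YangMills.Theorems.BalabanUVNodesN19JointLawPriceCompositionsOuterPolynomial
import Summits.QuantumFields.YangMills.Theorems.BalabanUVNodesN19JointLawPriceDimensionSharp

/-!
# YM-DAG node N19 (= NE7 proper) — FUNCTIONALS OF `k` OF THE `d` STRINGS COST `Θ(k²∕(k + log r⁻¹))` under uniform mixed moments (two-sided,
# by restriction and zero-padding)

Cell `pub-ymgap`, HUMAN RULING D-0062 (Track A) ∕ D-0149 (work-bound push), R141 (C) wider-strategy seat `pub-ymgap-dag-n19-e` (strategy
s3 = ALTERNATIVE CURRENCY), generation g28, module 3 (lineage module 114).  Route `Summits/QuantumFields/YangMills/Theses/BalabanUVNodes.lean`,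
cluster item K3⁸ «SpineGivenEndpointR13SepCoPHV» (stmt-QuantumFields-27366); filed `--supports` that item `--as helper` (it proves no registered
stub).  COUNT-NEUTRAL: [folklore] push-forward bookkeeping over module 65 `…N19JointLawPriceDimension` (`law_price_le_of_uniformMixedMoments`:
`(76Kd² + 12Gd)∕(1 + log r⁻¹)` for ℓ¹-Lipschitz functionals), module 107 `…N19JointLawPriceDimensionSharp` (`jointLaw_price_general_two_sided`:
the Tchakaloff-cubature witness paying `d²∕(256(d + log r⁻¹))`) and module 112 `…N19JointLawPriceCompositionsOuterPolynomial` (§4: the map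
`a ↦ (a_{b i})_i` — here with the roles of the index types swapped it is the RESTRICTION to a sub-family of strings; `map_blockEmbed_carried`,
`integral_map_blockEmbed`, `moments_close_map_blockEmbed` BY NAME); no scheme object, no Theses import; NOT a discharge claim.

THE STATEMENT (CURRENCY-MAP v6, «not typed» item).  Under `r`-closeness of ALL mixed moments of two laws `P, Q` on `[−1,1]^ι` (`d = |ι|`,
`L = log r⁻¹`), a functional that depends only on the strings of a sub-family `e : κ ↪ ι` (`k = |κ|`) and is ℓ¹-`K`-Lipschitz, `G`-bounded as a
function of those `k` strings is paid `≤ (76K k² + 12G k)∕(1 + L)` — the MARGINAL laws on `[−1,1]^κ` inherit the mixed-moment closeness (their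
exponent vectors are among those of `ι`) and module 65 applies in dimension `k`; conversely module 107's `k`-dimensional witness, PADDED WITH
ZEROS in the remaining `d − k` coordinates, is a pair of laws on `[−1,1]^ι` with ALL mixed moments still `r`-close (a monomial with a positive
exponent off the sub-family integrates to `0` under both) and a `k`-string test paying `k²∕(256(k + L))`.  So the joint-law price of a
`k`-sub-family is `Θ(k²∕(k + L))`, whatever the ambient `d`: the factor of module 107 counts the strings a functional actually touches.
§1 RESTRICTION: `law_price_coordSubset_le` (upper bound, module 65 on the marginals via module 112 §4).
§2 ZERO-PADDING `pad e a = Function.extend e a 0`: `pad_apply` · `pad_apply_of_not_exists` · `continuous_pad` · `map_pad_carried` ·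
   `prod_pow_pad_of_exists` · `prod_pow_pad_of_forall` · ★ `moments_close_map_pad` · `integral_comp_restrict_map_pad`.
§3 ★★ `jointLaw_price_coordSubset_two_sided`: the two bounds side by side for an arbitrary embedding `e : κ ↪ ι`.
READING for N19 (honest): under the uniform target the convergence rate of a joint functional of a sub-family of `k` strings is `≍ k²∕log R_K⁻¹`,
independently of how many other strings are carried along.  [folklore]; TOY laws.

HONEST FRAMING (binding).  Elementary bookkeeping; NO consumer in the DAG today; nothing of Bałaban's instantiated; NE7 NOT PRINTED, NOT proved;
N19 NOT discharged; count-neutral.  One finite `T⁴` programme at fixed `ε`; nothing continuum ∕ `ℝ⁴` ∕ OS ∕ mass-gap ∕ Clay.  0 `def` (the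
padding map is Mathlib's `Function.extend`, written out inside the statements) ∕ 0 `sorry`.
-/

noncomputable section

open Real Finset MeasureTheory

namespace Summit.QuantumFields.YangMills.Theorems.BalabanUVNodesN19JointLawPriceCoordinateSubsets

open Summit.QuantumFields.YangMills.Theorems.BalabanUVNodesN19JointLawPriceDimension (law_price_le_of_uniformMixedMoments)
open Summit.QuantumFields.YangMills.Theorems.BalabanUVNodesN19JointLawPriceDimensionSharp (jointLaw_price_general_two_sided)
open Summit.QuantumFields.YangMills.Theorems.BalabanUVNodesN19JointLawPriceCompositionsOuterPolynomial
  (continuous_blockEmbed map_blockEmbed_carried integral_map_blockEmbed moments_close_map_blockEmbed)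

variable {ι : Type*} [Fintype ι] [DecidableEq ι] {κ : Type*} [Fintype κ] [DecidableEq κ]

/-! ## §1 Restriction to a sub-family of strings: the upper bound `(76K k² + 12G k)∕(1 + log r⁻¹)` [folklore] -/

omit [DecidableEq κ] in
/-- ★ **FUNCTIONALS OF `k` OF THE `d` STRINGS: UPPER BOUND.**  `P, Q` on `[−1,1]^ι` with all mixed moments `r`-close (`0 < r ≤ 1`); `e : κ → ι`
any map (an embedding of the sub-family in applications; `κ` nonempty, `k = |κ|`); `F` continuous on `ℝ^κ`, ℓ¹-`K`-Lipschitz and `G`-bounded on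
the cube.  Then `|∫F(x ∘ e) dP − ∫F(x ∘ e) dQ| ≤ (76K k² + 12G k)∕(1 + log r⁻¹)` — the marginals `P∘(· ∘ e)⁻¹`, `Q∘(· ∘ e)⁻¹` are carried by
`[−1,1]^κ` and have all mixed moments `r`-close (module 112 §4), so module 65 applies in dimension `k`. [folklore] -/
theorem law_price_coordSubset_le [Nonempty κ] (e : κ → ι) {P Q : Measure (ι → ℝ)} [IsProbabilityMeasure P] [IsProbabilityMeasure Q]
    (hP : P (Set.pi Set.univ (fun _ : ι => Set.Icc (-1 : ℝ) 1))ᶜ = 0) (hQ : Q (Set.pi Set.univ (fun _ : ι => Set.Icc (-1 : ℝ) 1))ᶜ = 0)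
    {r : ℝ} (hr0 : 0 < r) (hr1 : r ≤ 1) (hmom : ∀ j : ι → ℕ, |∫ x, ∏ i, x i ^ j i ∂P - ∫ x, ∏ i, x i ^ j i ∂Q| ≤ r)
    {F : (κ → ℝ) → ℝ} (hF : Continuous F) {K G : ℝ} (hK0 : 0 ≤ K)
    (hK : ∀ u v : κ → ℝ, (∀ c, u c ∈ Set.Icc (-1 : ℝ) 1) → (∀ c, v c ∈ Set.Icc (-1 : ℝ) 1) → |F u - F v| ≤ K * ∑ c, |u c - v c|)
    (hG : ∀ u : κ → ℝ, (∀ c, u c ∈ Set.Icc (-1 : ℝ) 1) → |F u| ≤ G) :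
    |∫ x, F (fun c => x (e c)) ∂P - ∫ x, F (fun c => x (e c)) ∂Q| ≤
      (76 * K * (Fintype.card κ : ℝ) ^ 2 + 12 * G * Fintype.card κ) / (1 + Real.log r⁻¹) := by
  haveI : IsProbabilityMeasure (P.map fun (x : ι → ℝ) (c : κ) => x (e c)) :=
    Measure.isProbabilityMeasure_map (continuous_blockEmbed e).measurable.aemeasurable
  haveI : IsProbabilityMeasure (Q.map fun (x : ι → ℝ) (c : κ) => x (e c)) :=
    Measure.isProbabilityMeasure_map (continuous_blockEmbed e).measurable.aemeasurable
  rw [← integral_map_blockEmbed e P hF, ← integral_map_blockEmbed e Q hF]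
  exact law_price_le_of_uniformMixedMoments (map_blockEmbed_carried e hP) (map_blockEmbed_carried e hQ) hr0 hr1
    (moments_close_map_blockEmbed e hmom) hF hK0 hK hG

/-! ## §2 Zero-padding of a sub-family [folklore] -/

omit [Fintype ι] [DecidableEq ι] [Fintype κ] [DecidableEq κ] in
/-- The padding `Function.extend e a 0` agrees with `a` on the sub-family (`e` injective). [bookkeeping] -/
theorem pad_apply {e : κ → ι} (he : Function.Injective e) (a : κ → ℝ) (c : κ) :
    Function.extend e a (0 : ι → ℝ) (e c) = a c :=
  he.extend_apply a (0 : ι → ℝ) c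

omit [Fintype ι] [DecidableEq ι] [Fintype κ] [DecidableEq κ] in
/-- The padding vanishes off the sub-family. [bookkeeping] -/
theorem pad_apply_of_not_exists (e : κ → ι) (a : κ → ℝ) {i : ι} (hi : ¬∃ c, e c = i) :
    Function.extend e a (0 : ι → ℝ) i = 0 := by
  rw [Function.extend_apply' a (0 : ι → ℝ) i hi, Pi.zero_apply]

omit [Fintype ι] [DecidableEq ι] [DecidableEq κ] in
/-- The padding map `a ↦ Function.extend e a 0` is continuous (`e` injective). [bookkeeping] -/
theorem continuous_pad {e : κ → ι} (he : Function.Injective e) :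
    Continuous fun (a : κ → ℝ) => Function.extend e a (0 : ι → ℝ) := by
  refine continuous_pi fun i => ?_
  by_cases hi : ∃ c, e c = i
  · obtain ⟨c, rfl⟩ := hi
    simp only [he.extend_apply]
    exact continuous_apply c
  · simp only [Function.extend_apply' _ _ _ hi]
    exact continuous_const

omit [DecidableEq ι] [DecidableEq κ] in
/-- A law carried by `[−1,1]^κ` pads to a law carried by `[−1,1]^ι`. [bookkeeping] -/
theorem map_pad_carried {e : κ → ι} (he : Function.Injective e) {P : Measure (κ → ℝ)}
    (hP : P (Set.pi Set.univ (fun _ : κ => Set.Icc (-1 : ℝ) 1))ᶜ = 0) :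
    (P.map fun (a : κ → ℝ) => Function.extend e a (0 : ι → ℝ)) (Set.pi Set.univ (fun _ : ι => Set.Icc (-1 : ℝ) 1))ᶜ = 0 := by
  rw [Measure.map_apply (continuous_pad he).measurable (MeasurableSet.univ_pi fun _ => measurableSet_Icc).compl]
  refine measure_mono_null (fun a ha => ?_) hP
  intro hacube
  apply ha
  refine Set.mem_univ_pi.2 fun i => ?_
  show Function.extend e a (0 : ι → ℝ) i ∈ Set.Icc (-1 : ℝ) 1
  by_cases hi : ∃ c, e c = i
  · obtain ⟨c, rfl⟩ := hi
    rw [pad_apply he]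
    exact Set.mem_univ_pi.1 hacube c
  · rw [pad_apply_of_not_exists e a hi]
    exact ⟨by norm_num, by norm_num⟩

omit [DecidableEq ι] [Fintype κ] [DecidableEq κ] in
/-- A mixed monomial with a positive exponent OFF the sub-family vanishes on padded points. [bookkeeping] -/
theorem prod_pow_pad_of_exists (e : κ → ι) (a : κ → ℝ) {j : ι → ℕ} (hj : ∃ i, (¬∃ c, e c = i) ∧ j i ≠ 0) :
    ∏ i, (Function.extend e a (0 : ι → ℝ)) i ^ j i = 0 := by
  obtain ⟨i, hi, hji⟩ := hj
  exact Finset.prod_eq_zero (Finset.mem_univ i) (by rw [pad_apply_of_not_exists e a hi, zero_pow hji])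

omit [DecidableEq κ] in
/-- A mixed monomial whose exponents vanish off the sub-family is the corresponding monomial of the sub-family on padded points (`e` injective).
[bookkeeping] -/
theorem prod_pow_pad_of_forall {e : κ → ι} (he : Function.Injective e) (a : κ → ℝ) {j : ι → ℕ}
    (hj : ∀ i, (¬∃ c, e c = i) → j i = 0) :
    ∏ i, (Function.extend e a (0 : ι → ℝ)) i ^ j i = ∏ c, a c ^ j (e c) := by
  classical
  rw [← Finset.prod_subset (Finset.subset_univ (Finset.univ.image e)) (fun i _ hi => by
    have hne : ¬∃ c, e c = i := fun ⟨c, hc⟩ => hi (Finset.mem_image.2 ⟨c, Finset.mem_univ c, hc⟩)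
    rw [hj i hne, pow_zero])]
  rw [Finset.prod_image fun c _ c' _ h => he h]
  exact Finset.prod_congr rfl fun c _ => by rw [pad_apply he]

omit [DecidableEq κ] in
/-- ★ **MIXED-MOMENT CLOSENESS SURVIVES ZERO-PADDING.**  If `P, Q` on `ℝ^κ` have ALL mixed moments `r`-close (`0 ≤ r`), so do their push-forwards
under the padding `a ↦ Function.extend e a 0` on `ℝ^ι` (`e` injective): an exponent vector with a positive entry off the sub-family integrates to
`0` under both, any other is a `κ`-moment. [folklore] -/
theorem moments_close_map_pad {e : κ → ι} (he : Function.Injective e) {P Q : Measure (κ → ℝ)}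
    {r : ℝ} (hr : 0 ≤ r) (hmom : ∀ j : κ → ℕ, |∫ a, ∏ c, a c ^ j c ∂P - ∫ a, ∏ c, a c ^ j c ∂Q| ≤ r) (j : ι → ℕ) :
    |∫ x, ∏ i, x i ^ j i ∂(P.map fun (a : κ → ℝ) => Function.extend e a (0 : ι → ℝ)) -
        ∫ x, ∏ i, x i ^ j i ∂(Q.map fun (a : κ → ℝ) => Function.extend e a (0 : ι → ℝ))| ≤ r := by
  have hc : Continuous fun x : ι → ℝ => ∏ i, x i ^ j i := continuous_finsetProd _ fun i _ => (continuous_apply i).pow _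
  rw [integral_map (continuous_pad he).measurable.aemeasurable hc.aestronglyMeasurable,
    integral_map (continuous_pad he).measurable.aemeasurable hc.aestronglyMeasurable]
  by_cases hj : ∃ i, (¬∃ c, e c = i) ∧ j i ≠ 0
  · simp only [prod_pow_pad_of_exists e _ hj, integral_zero, sub_zero, abs_zero]
    exact hr
  · have hj' : ∀ i, (¬∃ c, e c = i) → j i = 0 := fun i hi => by
      by_contra h
      exact hj ⟨i, hi, h⟩
    simp only [prod_pow_pad_of_forall he _ hj']
    exact hmom _

omit [DecidableEq ι] [DecidableEq κ] in
/-- A functional of the sub-family integrates against the padded law as it does against the original law. [bookkeeping] -/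
theorem integral_comp_restrict_map_pad {e : κ → ι} (he : Function.Injective e) (P : Measure (κ → ℝ))
    {F : (κ → ℝ) → ℝ} (hF : Continuous F) :
    ∫ x, F (fun c => x (e c)) ∂(P.map fun (a : κ → ℝ) => Function.extend e a (0 : ι → ℝ)) = ∫ a, F a ∂P := by
  have hc : Continuous fun x : ι → ℝ => F (fun c => x (e c)) := hF.comp (continuous_pi fun c => continuous_apply (e c))
  rw [integral_map (continuous_pad he).measurable.aemeasurable hc.aestronglyMeasurable]
  refine integral_congr_ae (Filter.Eventually.of_forall fun a => ?_)
  simp only [pad_apply he]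

/-! ## §3 ★★ The two-sided statement [folklore] -/

omit [DecidableEq κ] in
/-- ★★ **FUNCTIONALS OF A SUB-FAMILY OF `k` STRINGS ARE `Θ(k²∕(k + log r⁻¹))`, WHATEVER THE AMBIENT `d`.**  For an embedding `e : κ ↪ ι`
(`k = |κ| ≥ 1`, `d = |ι|`): (1) for all `P, Q` on `[−1,1]^ι` with all mixed moments `r`-close (`0 < r ≤ 1`) and every continuous `F` on
`ℝ^κ`, ℓ¹-`K`-Lipschitz and `G`-bounded on the cube, `|∫F(x∘e) dP − ∫F(x∘e) dQ| ≤ (76K k² + 12G k)∕(1 + log r⁻¹)`; (2) for every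
`0 < r₀ ≤ 1` there are `P, Q` on `[−1,1]^ι` with ALL mixed moments `r`-close for some `0 < r ≤ r₀` and a `1`-ℓ¹-Lipschitz `g ≥ 0` on `ℝ^κ`
(`≤ 2k` on the cube) with `k²∕(256(k + log r⁻¹)) ≤ |∫g(x∘e) dP − ∫g(x∘e) dQ|` — module 107's witness padded with zeros.  So the factor of
module 107 counts the strings a functional touches, not the strings carried along. [folklore] -/
theorem jointLaw_price_coordSubset_two_sided [Nonempty κ] (e : κ ↪ ι) :
    (∀ (P Q : Measure (ι → ℝ)) [IsProbabilityMeasure P] [IsProbabilityMeasure Q],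
      P (Set.pi Set.univ (fun _ : ι => Set.Icc (-1 : ℝ) 1))ᶜ = 0 → Q (Set.pi Set.univ (fun _ : ι => Set.Icc (-1 : ℝ) 1))ᶜ = 0 →
      ∀ r : ℝ, 0 < r → r ≤ 1 → (∀ j : ι → ℕ, |∫ x, ∏ i, x i ^ j i ∂P - ∫ x, ∏ i, x i ^ j i ∂Q| ≤ r) →
      ∀ F : (κ → ℝ) → ℝ, Continuous F → ∀ K G : ℝ, 0 ≤ K →
        (∀ u v : κ → ℝ, (∀ c, u c ∈ Set.Icc (-1 : ℝ) 1) → (∀ c, v c ∈ Set.Icc (-1 : ℝ) 1) → |F u - F v| ≤ K * ∑ c, |u c - v c|) →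
        (∀ u : κ → ℝ, (∀ c, u c ∈ Set.Icc (-1 : ℝ) 1) → |F u| ≤ G) →
        |∫ x, F (fun c => x (e c)) ∂P - ∫ x, F (fun c => x (e c)) ∂Q| ≤
          (76 * K * (Fintype.card κ : ℝ) ^ 2 + 12 * G * Fintype.card κ) / (1 + Real.log r⁻¹)) ∧
    (∀ r₀ : ℝ, 0 < r₀ → r₀ ≤ 1 → ∃ P Q : Measure (ι → ℝ), IsProbabilityMeasure P ∧ IsProbabilityMeasure Q ∧
      P (Set.pi Set.univ (fun _ : ι => Set.Icc (-1 : ℝ) 1))ᶜ = 0 ∧ Q (Set.pi Set.univ (fun _ : ι => Set.Icc (-1 : ℝ) 1))ᶜ = 0 ∧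
      ∃ r : ℝ, 0 < r ∧ r ≤ r₀ ∧ (∀ j : ι → ℕ, |∫ x, ∏ i, x i ^ j i ∂P - ∫ x, ∏ i, x i ^ j i ∂Q| ≤ r) ∧
        ∃ g : (κ → ℝ) → ℝ, Continuous g ∧ (∀ u v : κ → ℝ, |g u - g v| ≤ ∑ c, |u c - v c|) ∧ (∀ u, 0 ≤ g u) ∧
          (∀ u : κ → ℝ, (∀ c, u c ∈ Set.Icc (-1 : ℝ) 1) → |g u| ≤ 2 * Fintype.card κ) ∧
          (Fintype.card κ : ℝ) ^ 2 / (256 * (Fintype.card κ + Real.log r⁻¹)) ≤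
            |∫ x, g (fun c => x (e c)) ∂P - ∫ x, g (fun c => x (e c)) ∂Q|) := by
  refine ⟨fun P Q _ _ hP hQ r hr0 hr1 hmom F hF K G hK0 hK hG => law_price_coordSubset_le e hP hQ hr0 hr1 hmom hF hK0 hK hG,
    fun r₀ hr₀ hr₀1 => ?_⟩
  obtain ⟨P, Q, hPp, hQp, hP, hQ, r, hr0, hrr, hmom, g, hgc, hgL, hg0, hgB, hpay⟩ :=
    (jointLaw_price_general_two_sided κ).2 r₀ hr₀ hr₀1
  have he : Function.Injective e := e.injective
  haveI : IsProbabilityMeasure (P.map fun (a : κ → ℝ) => Function.extend e a (0 : ι → ℝ)) :=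
    Measure.isProbabilityMeasure_map (continuous_pad he).measurable.aemeasurable
  haveI : IsProbabilityMeasure (Q.map fun (a : κ → ℝ) => Function.extend e a (0 : ι → ℝ)) :=
    Measure.isProbabilityMeasure_map (continuous_pad he).measurable.aemeasurable
  refine ⟨P.map fun (a : κ → ℝ) => Function.extend e a (0 : ι → ℝ), Q.map fun (a : κ → ℝ) => Function.extend e a (0 : ι → ℝ),
    inferInstance, inferInstance, map_pad_carried he hP, map_pad_carried he hQ, r, hr0, hrr,
    moments_close_map_pad he hr0.le hmom, g, hgc, hgL, hg0, hgB, ?_⟩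
  rw [integral_comp_restrict_map_pad he P hgc, integral_comp_restrict_map_pad he Q hgc]
  exact hpay

end Summit.QuantumFields.YangMills.Theorems.BalabanUVNodesN19JointLawPriceCoordinateSubsets

end
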